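import Mathlib
import HarnessLib
import Literature.Analysis.FluidPDE.BeltramiFlows
import Literature.Analysis.Calculus.SimplifiedNewton
import Literature.Analysis.Distribution.ExpTailSharpBound
import Summits.NavierStokesRegularity.FluidComputer.ABCSkeletonPersistenceLocal

/-!
# Persistence of the ABC 1:1:1 stagnation points — FROZEN-NEWTON DATA FORM (the exact Jacobian `A = DU(x₀) + G'(x₀)`
# instead of the margin `c = √2/2 − ‖G'(x₀)‖`)
# (instab lane, door O-acc = O7 / obstruction P3; third file of the chain `ABCSkeletonPersistence` (p438791, global form,
# host constant 2) → `ABCSkeletonPersistenceLocal` (ball hypotheses; host Jacobian 1-Lipschitz) → this; cell `ns-blowup`,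
# seat `ns-blowup-instab2`)

HONEST FRAMING (human ruling D-0035): nothing here is a claim about Navier–Stokes. WHAT THIS IS NOT: not dynamics —
calculus on the tree's ABC field `U = Literature.Analysis.FluidPDE.ABC.abc 1 1 1` on `E = EuclideanSpace ℝ (Fin 3)`
and the tree's simplified-Newton theorem `Literature.Analysis.Calculus.exists_zero_near_of_simplifiedNewton`
(Magnus 2022, Prop. 6.7). `G` is a free field (in the cell's use: `u(·,t)/a(t) − U` of a P-TOWER snapshot).

## Why a third form
The local forms bound `‖A⁻¹‖ ≤ 1/c` with `c = √2/2 − ‖G'(x₀)‖`: they need `‖G'(x₀)‖ < √2/2` and discard the conditioning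
of the actual matrix `A = DU(x₀) + G'(x₀)`. A velocity snapshot KNOWS `A` (a `3 × 3` matrix), so `β = ‖A⁻¹‖ = 1/σ_min(A)`
and the Newton step `η = ‖A⁻¹G(x₀)‖` are computable, and Magnus's theorem applies verbatim with them: no margin
hypothesis, only `A` invertible, the RADIAL Lipschitz bound of `G'` on a ball containing the Newton ball `B̄(x₀, 2η)`,
and `4(1 + M)βη ≤ 1`. On the cell's data this is the form that decides (instrument `skeleton_persist.py` v1.2): a
skeleton point whose perturbation gradient has passed the host's smallest strain rate `√2/2` (verdict «LAPSED» of
v1.0/v1.1) can still be certified when `DU(x₀) + G'(x₀)` is well-conditioned and `G(x₀)` is small.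

## What is proved (no definitions; Mathlib + `BeltramiFlows` + `SimplifiedNewton` + `ABCSkeletonPersistenceLocal`)
* **`exists_unique_zero_near_of_abc_eq_zero_newton`**: `U x₀ = 0`; `A : E ≃L E` with `DU(x₀) + G'(x₀) = A`;
  `2‖A⁻¹G(x₀)‖ ≤ ρ`; `G` differentiable with derivative `G'` on `B̄(x₀, ρ)`; `‖G'(x) − G'(x₀)‖ ≤ M‖x − x₀‖` there
  (`0 ≤ M`); `4(1 + M)‖A⁻¹‖‖A⁻¹G(x₀)‖ ≤ 1` ⟹ EXACTLY ONE zero of `U + G` in `B̄(x₀, 2‖A⁻¹G(x₀)‖)`, non-degenerate;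
* `exists_unique_zero_near_of_abc_eq_zero_newton_hessian`: the same with the radial bound supplied by `‖DG'‖ ≤ M` on
  the ball (mean value, `ABCSkeletonPersistenceLocal.radial_lipschitz_of_norm_fderiv_le`).
The four numbers a snapshot must produce per skeleton point: `η = ‖A⁻¹G(x₀)‖`, `β = ‖A⁻¹‖`, a radius `ρ ≥ 2η`, and ONE
bound `M` on the radial Lipschitz constant of `∇G` at `x₀` over `B̄(x₀, ρ)` (Taylor series of `∇G` at `x₀` with remainder,
or a covering bound on `sup ‖∇²G‖`); then check `4(1 + M)βη ≤ 1`.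
LABEL: MODEL-door kinematics. WHAT THIS IS NOT: not NS; nothing is evolved; `G` is a free field.
-/

namespace Summit.NavierStokesRegularity.FluidComputer.ABCSkeletonPersistenceNewton

open Real Metric Set Literature.Analysis.FluidPDE ABCSkeletonPersistence ABCSkeletonPersistenceLocal

/-- **PERSISTENCE, FROZEN-NEWTON DATA FORM.** Let `U x₀ = 0`, let `G` be differentiable with derivative `G'` on
`B̄(x₀, ρ)`, let `A : E ≃L E` be the exact perturbed Jacobian at the point, `DU(x₀) + G'(x₀) = A`, put
`η := ‖A⁻¹G(x₀)‖` and suppose `2η ≤ ρ`, the RADIAL bound `‖G'(x) − G'(x₀)‖ ≤ M‖x − x₀‖` on `B̄(x₀, ρ)` (`0 ≤ M`), and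
Magnus's smallness `4(1 + M)‖A⁻¹‖η ≤ 1` (host Jacobian `1`-Lipschitz, `norm_fderiv_sub_fderiv_le_dist`). Then `U + G`
has EXACTLY ONE zero in the closed Newton ball `B̄(x₀, 2η)`, and it is non-degenerate. No hypothesis
`‖G'(x₀)‖ < √2/2` is needed (Magnus 2022 Prop. 6.7 = tree `exists_zero_near_of_simplifiedNewton` with `f = U + G`,
`f' = DU + G'`, Lipschitz constant `1 + M` on the Newton ball, which lies inside `B̄(x₀, ρ)`). -/
theorem exists_unique_zero_near_of_abc_eq_zero_newton {x₀ : EuclideanSpace ℝ (Fin 3)}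
    (h0 : ABC.abc 1 1 1 x₀ = 0)
    {G : EuclideanSpace ℝ (Fin 3) → EuclideanSpace ℝ (Fin 3)}
    {G' : EuclideanSpace ℝ (Fin 3) → EuclideanSpace ℝ (Fin 3) →L[ℝ] EuclideanSpace ℝ (Fin 3)}
    {A : EuclideanSpace ℝ (Fin 3) ≃L[ℝ] EuclideanSpace ℝ (Fin 3)} {M ρ : ℝ} (hM : 0 ≤ M)
    (hA : fderiv ℝ (ABC.abc 1 1 1) x₀ + G' x₀ = (A : EuclideanSpace ℝ (Fin 3) →L[ℝ] EuclideanSpace ℝ (Fin 3)))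
    (hρ : 2 * ‖A.symm (G x₀)‖ ≤ ρ)
    (hG : ∀ x ∈ closedBall x₀ ρ, HasFDerivAt G (G' x) x)
    (hlipG : ∀ x ∈ closedBall x₀ ρ, ‖G' x - G' x₀‖ ≤ M * ‖x - x₀‖)
    (hsmall : 4 * (1 + M) * ‖(A.symm : EuclideanSpace ℝ (Fin 3) →L[ℝ] EuclideanSpace ℝ (Fin 3))‖ *
      ‖A.symm (G x₀)‖ ≤ 1) :
    ∃ z ∈ closedBall x₀ (2 * ‖A.symm (G x₀)‖), ABC.abc 1 1 1 z + G z = 0 ∧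
      (fderiv ℝ (ABC.abc 1 1 1) z + G' z).IsInvertible ∧
        ∀ y ∈ closedBall x₀ (2 * ‖A.symm (G x₀)‖), ABC.abc 1 1 1 y + G y = 0 → y = z := by
  set f : EuclideanSpace ℝ (Fin 3) → EuclideanSpace ℝ (Fin 3) := fun x => ABC.abc 1 1 1 x + G x with hf_def
  set f' : EuclideanSpace ℝ (Fin 3) → EuclideanSpace ℝ (Fin 3) →L[ℝ] EuclideanSpace ℝ (Fin 3) :=
    fun x => fderiv ℝ (ABC.abc 1 1 1) x + G' x with hf'_def
  have hfa : f x₀ = G x₀ := by simp [hf_def, h0]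
  have ha : f' x₀ = (A : EuclideanSpace ℝ (Fin 3) →L[ℝ] EuclideanSpace ℝ (Fin 3)) := hA
  have hsub : closedBall x₀ (2 * ‖A.symm (f x₀)‖) ⊆ closedBall x₀ ρ := by
    rw [hfa]; exact closedBall_subset_closedBall hρ
  have hf : ∀ x ∈ closedBall x₀ (2 * ‖A.symm (f x₀)‖), HasFDerivAt f (f' x) x := fun x hx =>
    ((ABC.differentiable_abc 1 1 1 x).hasFDerivAt).add (hG x (hsub hx))
  have hlip : ∀ x ∈ closedBall x₀ (2 * ‖A.symm (f x₀)‖), ‖f' x - f' x₀‖ ≤ (1 + M) * ‖x - x₀‖ := fun x hx =>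
    norm_fderiv_add_sub_le_of_radial_one (hlipG x (hsub hx))
  have hcond : 4 * (1 + M) * ‖(A.symm : EuclideanSpace ℝ (Fin 3) →L[ℝ] EuclideanSpace ℝ (Fin 3))‖ *
      ‖A.symm (f x₀)‖ ≤ 1 := by rw [hfa]; exact hsmall
  obtain ⟨z, hz, hfz, hinv, huniq, -⟩ :=
    Literature.Analysis.Calculus.exists_zero_near_of_simplifiedNewton (f := f) (f' := f') (a := x₀) (A := A)
      (M := 1 + M) (by positivity) hf ha hlip hcond
  rw [hfa] at hz huniq
  exact ⟨z, hz, hfz, hinv, huniq⟩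

/-- **FROZEN-NEWTON DATA FORM WITH A HESSIAN BOUND**: as `exists_unique_zero_near_of_abc_eq_zero_newton` with the
radial bound supplied by `‖DG'‖ ≤ M` on `B̄(x₀, ρ)` (mean value). The four numbers a snapshot must produce:
`η = ‖A⁻¹G(x₀)‖`, `β = ‖A⁻¹‖`, `M ≥ sup_{B̄(x₀,ρ)} ‖∇²G‖` for some `ρ ≥ 2η`, and the check `4(1 + M)βη ≤ 1`. -/
theorem exists_unique_zero_near_of_abc_eq_zero_newton_hessian {x₀ : EuclideanSpace ℝ (Fin 3)}
    (h0 : ABC.abc 1 1 1 x₀ = 0)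
    {G : EuclideanSpace ℝ (Fin 3) → EuclideanSpace ℝ (Fin 3)}
    {G' : EuclideanSpace ℝ (Fin 3) → EuclideanSpace ℝ (Fin 3) →L[ℝ] EuclideanSpace ℝ (Fin 3)}
    {G'' : EuclideanSpace ℝ (Fin 3) →
      EuclideanSpace ℝ (Fin 3) →L[ℝ] (EuclideanSpace ℝ (Fin 3) →L[ℝ] EuclideanSpace ℝ (Fin 3))}
    {A : EuclideanSpace ℝ (Fin 3) ≃L[ℝ] EuclideanSpace ℝ (Fin 3)} {M ρ : ℝ} (hM : 0 ≤ M)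
    (hA : fderiv ℝ (ABC.abc 1 1 1) x₀ + G' x₀ = (A : EuclideanSpace ℝ (Fin 3) →L[ℝ] EuclideanSpace ℝ (Fin 3)))
    (hρ : 2 * ‖A.symm (G x₀)‖ ≤ ρ)
    (hG : ∀ x ∈ closedBall x₀ ρ, HasFDerivAt G (G' x) x)
    (hG'' : ∀ x ∈ closedBall x₀ ρ, HasFDerivAt G' (G'' x) x) (hbound : ∀ x ∈ closedBall x₀ ρ, ‖G'' x‖ ≤ M)
    (hsmall : 4 * (1 + M) * ‖(A.symm : EuclideanSpace ℝ (Fin 3) →L[ℝ] EuclideanSpace ℝ (Fin 3))‖ *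
      ‖A.symm (G x₀)‖ ≤ 1) :
    ∃ z ∈ closedBall x₀ (2 * ‖A.symm (G x₀)‖), ABC.abc 1 1 1 z + G z = 0 ∧
      (fderiv ℝ (ABC.abc 1 1 1) z + G' z).IsInvertible ∧
        ∀ y ∈ closedBall x₀ (2 * ‖A.symm (G x₀)‖), ABC.abc 1 1 1 y + G y = 0 → y = z :=
  exists_unique_zero_near_of_abc_eq_zero_newton h0 hM hA hρ hG (radial_lipschitz_of_norm_fderiv_le hG'' hbound) hsmall

/-- **EQUIVALENCE-FREE PACKAGING** (how the instrument states it): if the continuous linear map `DU(x₀) + G'(x₀)` is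
bounded below, `σ‖v‖ ≤ ‖(DU(x₀) + G'(x₀))v‖` with `σ > 0` (numerically: the smallest singular value of the `3 × 3`
matrix), then it IS an isomorphism `A` with `‖A⁻¹‖ ≤ 1/σ` (`ABCSkeletonPersistence.exists_equiv_of_bound_below`),
`η ≤ ‖G(x₀)‖/σ`, and the Newton form applies with `ρ ≥ 2‖G(x₀)‖/σ` and smallness `4(1 + M)‖G(x₀)‖ ≤ σ²`: exactly one
zero within `2‖G(x₀)‖/σ` of `x₀`, non-degenerate. With `σ = √2/2 − ‖G'(x₀)‖` this is §6's `_local_one`; with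
`σ = σ_min(DU(x₀) + G'(x₀))` it is sharper. -/
theorem exists_unique_zero_near_of_abc_eq_zero_sigma {x₀ : EuclideanSpace ℝ (Fin 3)}
    (h0 : ABC.abc 1 1 1 x₀ = 0)
    {G : EuclideanSpace ℝ (Fin 3) → EuclideanSpace ℝ (Fin 3)}
    {G' : EuclideanSpace ℝ (Fin 3) → EuclideanSpace ℝ (Fin 3) →L[ℝ] EuclideanSpace ℝ (Fin 3)}
    {M σ ρ : ℝ} (hM : 0 ≤ M) (hσ : 0 < σ)
    (hbelow : ∀ v, σ * ‖v‖ ≤ ‖(fderiv ℝ (ABC.abc 1 1 1) x₀ + G' x₀) v‖)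
    (hρ : 2 * ‖G x₀‖ / σ ≤ ρ)
    (hG : ∀ x ∈ closedBall x₀ ρ, HasFDerivAt G (G' x) x)
    (hlipG : ∀ x ∈ closedBall x₀ ρ, ‖G' x - G' x₀‖ ≤ M * ‖x - x₀‖)
    (hsmall : 4 * (1 + M) * ‖G x₀‖ ≤ σ ^ 2) :
    ∃ r : ℝ, 0 ≤ r ∧ r ≤ 2 * ‖G x₀‖ / σ ∧
      ∃ z ∈ closedBall x₀ r, ABC.abc 1 1 1 z + G z = 0 ∧ (fderiv ℝ (ABC.abc 1 1 1) z + G' z).IsInvertible ∧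
        ∀ y ∈ closedBall x₀ r, ABC.abc 1 1 1 y + G y = 0 → y = z := by
  obtain ⟨A, hA, hβ⟩ := exists_equiv_of_bound_below (fderiv ℝ (ABC.abc 1 1 1) x₀ + G' x₀) hσ hbelow
  set η : ℝ := ‖A.symm (G x₀)‖ with hη_def
  have hη : η ≤ ‖G x₀‖ / σ := by
    calc η = ‖(A.symm : EuclideanSpace ℝ (Fin 3) →L[ℝ] EuclideanSpace ℝ (Fin 3)) (G x₀)‖ := rfl
      _ ≤ ‖(A.symm : EuclideanSpace ℝ (Fin 3) →L[ℝ] EuclideanSpace ℝ (Fin 3))‖ * ‖G x₀‖ :=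
          ContinuousLinearMap.le_opNorm _ _
      _ ≤ 1 / σ * ‖G x₀‖ := mul_le_mul_of_nonneg_right hβ (norm_nonneg _)
      _ = ‖G x₀‖ / σ := by ring
  have h2η : 2 * η ≤ 2 * ‖G x₀‖ / σ := by
    rw [mul_div_assoc]; exact mul_le_mul_of_nonneg_left hη (by norm_num)
  have hβ0 : 0 ≤ ‖(A.symm : EuclideanSpace ℝ (Fin 3) →L[ℝ] EuclideanSpace ℝ (Fin 3))‖ := norm_nonneg _
  have hcond : 4 * (1 + M) * ‖(A.symm : EuclideanSpace ℝ (Fin 3) →L[ℝ] EuclideanSpace ℝ (Fin 3))‖ * η ≤ 1 := by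
    have h1 : 4 * (1 + M) * ‖(A.symm : EuclideanSpace ℝ (Fin 3) →L[ℝ] EuclideanSpace ℝ (Fin 3))‖ * η ≤
        4 * (1 + M) * (1 / σ) * (‖G x₀‖ / σ) := by
      have h2M : 0 ≤ 4 * (1 + M) := by positivity
      calc 4 * (1 + M) * ‖(A.symm : EuclideanSpace ℝ (Fin 3) →L[ℝ] EuclideanSpace ℝ (Fin 3))‖ * η
          ≤ 4 * (1 + M) * (1 / σ) * η := by gcongr
        _ ≤ 4 * (1 + M) * (1 / σ) * (‖G x₀‖ / σ) := by gcongr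
    have h2 : 4 * (1 + M) * (1 / σ) * (‖G x₀‖ / σ) = (4 * (1 + M) * ‖G x₀‖) / σ ^ 2 := by
      field_simp
    have h3 : (4 * (1 + M) * ‖G x₀‖) / σ ^ 2 ≤ 1 := by
      rw [div_le_one (by positivity)]; exact hsmall
    exact h1.trans (h2.le.trans h3)
  obtain ⟨z, hz, hfz, hinv, huniq⟩ :=
    exists_unique_zero_near_of_abc_eq_zero_newton h0 hM hA.symm (h2η.trans hρ) hG hlipG hcond
  exact ⟨2 * η, by positivity, h2η, z, hz, hfz, hinv, huniq⟩

/-! ## §2 (appended, instab2 g7) Uniqueness on a LARGE ball: Magnus's conditions (i)–(ii) with a free radius `R`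

The Newton ball `B̄(x₀, 2η)` of §1 is tiny (`η = |A⁻¹G(x₀)|`). For COUNTING zeros in the period cell one wants, around
each skeleton point, the LARGEST ball in which the perturbed field has exactly one zero. Magnus's proof gives existence
and uniqueness on `B̄(x₀, R)` for every radius `R` with (i) `(1 + M)R‖A⁻¹‖ < 1` and (ii) `(1 + M)R²‖A⁻¹‖ + η ≤ R`
(tree `existsUnique_zero_of_simplifiedNewton`), `M` = the radial Lipschitz bound of `G'` on that ball; `R` can be
as large as `≈ 1/((1 + M)‖A⁻¹‖)`. Instrument `skeleton_count.py` uses this ball as the exclusion zone around each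
skeleton point and certifies `|U + G| > 0` on the rest of the cell by a grid bound. -/

/-- **EXACTLY ONE ZERO IN A PRESCRIBED BALL.** Let `U x₀ = 0`, `A : E ≃L E` with `DU(x₀) + G'(x₀) = A`, `0 ≤ R`,
`0 ≤ M`, `G` differentiable with derivative `G'` on `B̄(x₀, R)` and `‖G'(x) − G'(x₀)‖ ≤ M‖x − x₀‖` there. If
(i) `(1 + M)·R·‖A⁻¹‖ < 1` and (ii) `(1 + M)·R²·‖A⁻¹‖ + ‖A⁻¹G(x₀)‖ ≤ R`, then `U + G` has EXACTLY ONE zero in the closed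
ball `B̄(x₀, R)`, and it is non-degenerate (Magnus 2022 Prop. 6.7 (i)–(ii) = tree
`existsUnique_zero_of_simplifiedNewton` + `isInvertible_of_simplifiedNewton`, with `f = U + G`, Lipschitz constant
`1 + M` from `norm_fderiv_sub_fderiv_le_dist`). -/
theorem existsUnique_zero_ball_of_abc_eq_zero {x₀ : EuclideanSpace ℝ (Fin 3)}
    (h0 : ABC.abc 1 1 1 x₀ = 0)
    {G : EuclideanSpace ℝ (Fin 3) → EuclideanSpace ℝ (Fin 3)}
    {G' : EuclideanSpace ℝ (Fin 3) → EuclideanSpace ℝ (Fin 3) →L[ℝ] EuclideanSpace ℝ (Fin 3)}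
    {A : EuclideanSpace ℝ (Fin 3) ≃L[ℝ] EuclideanSpace ℝ (Fin 3)} {M R : ℝ} (hR : 0 ≤ R) (hM : 0 ≤ M)
    (hA : fderiv ℝ (ABC.abc 1 1 1) x₀ + G' x₀ = (A : EuclideanSpace ℝ (Fin 3) →L[ℝ] EuclideanSpace ℝ (Fin 3)))
    (hG : ∀ x ∈ closedBall x₀ R, HasFDerivAt G (G' x) x)
    (hlipG : ∀ x ∈ closedBall x₀ R, ‖G' x - G' x₀‖ ≤ M * ‖x - x₀‖)
    (h₁ : (1 + M) * R * ‖(A.symm : EuclideanSpace ℝ (Fin 3) →L[ℝ] EuclideanSpace ℝ (Fin 3))‖ < 1)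
    (h₂ : (1 + M) * R ^ 2 * ‖(A.symm : EuclideanSpace ℝ (Fin 3) →L[ℝ] EuclideanSpace ℝ (Fin 3))‖ +
      ‖A.symm (G x₀)‖ ≤ R) :
    ∃ z ∈ closedBall x₀ R, ABC.abc 1 1 1 z + G z = 0 ∧ (fderiv ℝ (ABC.abc 1 1 1) z + G' z).IsInvertible ∧
      ∀ y ∈ closedBall x₀ R, ABC.abc 1 1 1 y + G y = 0 → y = z := by
  set f : EuclideanSpace ℝ (Fin 3) → EuclideanSpace ℝ (Fin 3) := fun x => ABC.abc 1 1 1 x + G x with hf_def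
  set f' : EuclideanSpace ℝ (Fin 3) → EuclideanSpace ℝ (Fin 3) →L[ℝ] EuclideanSpace ℝ (Fin 3) :=
    fun x => fderiv ℝ (ABC.abc 1 1 1) x + G' x with hf'_def
  have hfa : f x₀ = G x₀ := by simp [hf_def, h0]
  have ha : f' x₀ = (A : EuclideanSpace ℝ (Fin 3) →L[ℝ] EuclideanSpace ℝ (Fin 3)) := hA
  have hf : ∀ x ∈ closedBall x₀ R, HasFDerivAt f (f' x) x := fun x hx =>
    ((ABC.differentiable_abc 1 1 1 x).hasFDerivAt).add (hG x hx)
  have hlip : ∀ x ∈ closedBall x₀ R, ‖f' x - f' x₀‖ ≤ (1 + M) * ‖x - x₀‖ := fun x hx =>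
    norm_fderiv_add_sub_le_of_radial_one (hlipG x hx)
  have hM' : 0 ≤ 1 + M := by positivity
  have h₂' : (1 + M) * R ^ 2 * ‖(A.symm : EuclideanSpace ℝ (Fin 3) →L[ℝ] EuclideanSpace ℝ (Fin 3))‖ +
      ‖A.symm (f x₀)‖ ≤ R := by rw [hfa]; exact h₂
  obtain ⟨z, hz, hfz, huniq, -⟩ :=
    Literature.Analysis.Calculus.existsUnique_zero_of_simplifiedNewton (f := f) (f' := f') (a := x₀) (A := A)
      (M := 1 + M) hR hM' hf ha hlip h₁ h₂'
  exact ⟨z, hz, hfz, Literature.Analysis.Calculus.isInvertible_of_simplifiedNewton hM' ha (hlip z hz) hz h₁, huniq⟩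

/-- Equivalence-free packaging of §2: if `DU(x₀) + G'(x₀)` is bounded below by `σ > 0` then (i)–(ii) may be checked
with `‖A⁻¹‖ ≤ 1/σ` and `‖A⁻¹G(x₀)‖ ≤ ‖G(x₀)‖/σ`: `(1 + M)R < σ` and `(1 + M)R² + ‖G(x₀)‖ ≤ σR` ⟹ exactly one zero of
`U + G` in `B̄(x₀, R)`, non-degenerate. -/
theorem existsUnique_zero_ball_of_abc_eq_zero_sigma {x₀ : EuclideanSpace ℝ (Fin 3)}
    (h0 : ABC.abc 1 1 1 x₀ = 0)
    {G : EuclideanSpace ℝ (Fin 3) → EuclideanSpace ℝ (Fin 3)}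
    {G' : EuclideanSpace ℝ (Fin 3) → EuclideanSpace ℝ (Fin 3) →L[ℝ] EuclideanSpace ℝ (Fin 3)}
    {M R σ : ℝ} (hR : 0 ≤ R) (hM : 0 ≤ M) (hσ : 0 < σ)
    (hbelow : ∀ v, σ * ‖v‖ ≤ ‖(fderiv ℝ (ABC.abc 1 1 1) x₀ + G' x₀) v‖)
    (hG : ∀ x ∈ closedBall x₀ R, HasFDerivAt G (G' x) x)
    (hlipG : ∀ x ∈ closedBall x₀ R, ‖G' x - G' x₀‖ ≤ M * ‖x - x₀‖)
    (h₁ : (1 + M) * R < σ) (h₂ : (1 + M) * R ^ 2 + ‖G x₀‖ ≤ σ * R) :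
    ∃ z ∈ closedBall x₀ R, ABC.abc 1 1 1 z + G z = 0 ∧ (fderiv ℝ (ABC.abc 1 1 1) z + G' z).IsInvertible ∧
      ∀ y ∈ closedBall x₀ R, ABC.abc 1 1 1 y + G y = 0 → y = z := by
  obtain ⟨A, hA, hβ⟩ := exists_equiv_of_bound_below (fderiv ℝ (ABC.abc 1 1 1) x₀ + G' x₀) hσ hbelow
  have hβ0 : 0 ≤ ‖(A.symm : EuclideanSpace ℝ (Fin 3) →L[ℝ] EuclideanSpace ℝ (Fin 3))‖ := norm_nonneg _
  have hη : ‖A.symm (G x₀)‖ ≤ ‖G x₀‖ / σ := by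
    calc ‖A.symm (G x₀)‖ = ‖(A.symm : EuclideanSpace ℝ (Fin 3) →L[ℝ] EuclideanSpace ℝ (Fin 3)) (G x₀)‖ := rfl
      _ ≤ ‖(A.symm : EuclideanSpace ℝ (Fin 3) →L[ℝ] EuclideanSpace ℝ (Fin 3))‖ * ‖G x₀‖ :=
          ContinuousLinearMap.le_opNorm _ _
      _ ≤ 1 / σ * ‖G x₀‖ := mul_le_mul_of_nonneg_right hβ (norm_nonneg _)
      _ = ‖G x₀‖ / σ := by ring
  have hM' : 0 ≤ (1 + M) * R := by positivity
  have h₁' : (1 + M) * R * ‖(A.symm : EuclideanSpace ℝ (Fin 3) →L[ℝ] EuclideanSpace ℝ (Fin 3))‖ < 1 := by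
    calc (1 + M) * R * ‖(A.symm : EuclideanSpace ℝ (Fin 3) →L[ℝ] EuclideanSpace ℝ (Fin 3))‖
        ≤ (1 + M) * R * (1 / σ) := by gcongr
      _ = ((1 + M) * R) / σ := by ring
      _ < 1 := by rw [div_lt_one hσ]; exact h₁
  have h₂' : (1 + M) * R ^ 2 * ‖(A.symm : EuclideanSpace ℝ (Fin 3) →L[ℝ] EuclideanSpace ℝ (Fin 3))‖ +
      ‖A.symm (G x₀)‖ ≤ R := by
    have hMR2 : 0 ≤ (1 + M) * R ^ 2 := by positivity
    calc (1 + M) * R ^ 2 * ‖(A.symm : EuclideanSpace ℝ (Fin 3) →L[ℝ] EuclideanSpace ℝ (Fin 3))‖ + ‖A.symm (G x₀)‖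
        ≤ (1 + M) * R ^ 2 * (1 / σ) + ‖G x₀‖ / σ := by gcongr
      _ = ((1 + M) * R ^ 2 + ‖G x₀‖) / σ := by ring
      _ ≤ (σ * R) / σ := by gcongr
      _ = R := by field_simp
  exact existsUnique_zero_ball_of_abc_eq_zero h0 hR hM hA.symm hG hlipG h₁' h₂'

/-! ## §3 (appended, instab2 g7) Arbitrary centre: certify the DISPLACED zero where it actually is

§1–§2 expand about the skeleton point `x₀` itself, so their smallness conditions degrade as the zero drifts away from
`x₀` (residual `G(x₀)` grows) even when the displaced zero stays perfectly non-degenerate. Magnus's theorem does not care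
where the centre is: any approximate zero `a` of `U + G` (in practice a Newton-polished point, residual at rounding
level) with a well-conditioned Jacobian `DU(a) + G'(a)` carries a ball `B̄(a, R)` with exactly one zero. The census
statement «the zero of type α/β persists, displaced by `|a − x₀|`» is then certified with the displacement as a number. -/

/-- **EXACTLY ONE ZERO IN A BALL ABOUT AN ARBITRARY CENTRE.** Let `a ∈ E` be any point, `A : E ≃L E` with
`DU(a) + G'(a) = A`, `0 ≤ R`, `0 ≤ M`, `G` differentiable with derivative `G'` on `B̄(a, R)` and
`‖G'(x) − G'(a)‖ ≤ M‖x − a‖` there. If (i) `(1 + M)R‖A⁻¹‖ < 1` and (ii) `(1 + M)R²‖A⁻¹‖ + ‖A⁻¹(U(a) + G(a))‖ ≤ R`,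
then `U + G` has EXACTLY ONE zero in `B̄(a, R)`, non-degenerate (Magnus 2022 Prop. 6.7 (i)–(ii) with `f = U + G`,
host Jacobian `1`-Lipschitz). -/
theorem existsUnique_zero_ball_near (a : EuclideanSpace ℝ (Fin 3))
    {G : EuclideanSpace ℝ (Fin 3) → EuclideanSpace ℝ (Fin 3)}
    {G' : EuclideanSpace ℝ (Fin 3) → EuclideanSpace ℝ (Fin 3) →L[ℝ] EuclideanSpace ℝ (Fin 3)}
    {A : EuclideanSpace ℝ (Fin 3) ≃L[ℝ] EuclideanSpace ℝ (Fin 3)} {M R : ℝ} (hR : 0 ≤ R) (hM : 0 ≤ M)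
    (hA : fderiv ℝ (ABC.abc 1 1 1) a + G' a = (A : EuclideanSpace ℝ (Fin 3) →L[ℝ] EuclideanSpace ℝ (Fin 3)))
    (hG : ∀ x ∈ closedBall a R, HasFDerivAt G (G' x) x)
    (hlipG : ∀ x ∈ closedBall a R, ‖G' x - G' a‖ ≤ M * ‖x - a‖)
    (h₁ : (1 + M) * R * ‖(A.symm : EuclideanSpace ℝ (Fin 3) →L[ℝ] EuclideanSpace ℝ (Fin 3))‖ < 1)
    (h₂ : (1 + M) * R ^ 2 * ‖(A.symm : EuclideanSpace ℝ (Fin 3) →L[ℝ] EuclideanSpace ℝ (Fin 3))‖ +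
      ‖A.symm (ABC.abc 1 1 1 a + G a)‖ ≤ R) :
    ∃ z ∈ closedBall a R, ABC.abc 1 1 1 z + G z = 0 ∧ (fderiv ℝ (ABC.abc 1 1 1) z + G' z).IsInvertible ∧
      ∀ y ∈ closedBall a R, ABC.abc 1 1 1 y + G y = 0 → y = z := by
  set f : EuclideanSpace ℝ (Fin 3) → EuclideanSpace ℝ (Fin 3) := fun x => ABC.abc 1 1 1 x + G x with hf_def
  set f' : EuclideanSpace ℝ (Fin 3) → EuclideanSpace ℝ (Fin 3) →L[ℝ] EuclideanSpace ℝ (Fin 3) :=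
    fun x => fderiv ℝ (ABC.abc 1 1 1) x + G' x with hf'_def
  have ha : f' a = (A : EuclideanSpace ℝ (Fin 3) →L[ℝ] EuclideanSpace ℝ (Fin 3)) := hA
  have hf : ∀ x ∈ closedBall a R, HasFDerivAt f (f' x) x := fun x hx =>
    ((ABC.differentiable_abc 1 1 1 x).hasFDerivAt).add (hG x hx)
  have hlip : ∀ x ∈ closedBall a R, ‖f' x - f' a‖ ≤ (1 + M) * ‖x - a‖ := fun x hx =>
    norm_fderiv_add_sub_le_of_radial_one (hlipG x hx)
  have hM' : 0 ≤ 1 + M := by positivity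
  obtain ⟨z, hz, hfz, huniq, -⟩ :=
    Literature.Analysis.Calculus.existsUnique_zero_of_simplifiedNewton (f := f) (f' := f') (a := a) (A := A)
      (M := 1 + M) hR hM' hf ha hlip h₁ h₂
  exact ⟨z, hz, hfz, Literature.Analysis.Calculus.isInvertible_of_simplifiedNewton hM' ha (hlip z hz) hz h₁, huniq⟩

/-- Equivalence-free packaging of §3: `DU(a) + G'(a)` bounded below by `σ > 0`, `(1 + M)R < σ` and
`(1 + M)R² + ‖U(a) + G(a)‖ ≤ σR` ⟹ exactly one zero of `U + G` in `B̄(a, R)`, non-degenerate. The four numbers of a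
certificate row: the residual `‖U(a) + G(a)‖`, `σ = σ_min(DU(a) + G'(a))`, the radius `R`, the radial bound `M` on
`B̄(a, R)`. -/
theorem existsUnique_zero_ball_near_sigma (a : EuclideanSpace ℝ (Fin 3))
    {G : EuclideanSpace ℝ (Fin 3) → EuclideanSpace ℝ (Fin 3)}
    {G' : EuclideanSpace ℝ (Fin 3) → EuclideanSpace ℝ (Fin 3) →L[ℝ] EuclideanSpace ℝ (Fin 3)}
    {M R σ : ℝ} (hR : 0 ≤ R) (hM : 0 ≤ M) (hσ : 0 < σ)
    (hbelow : ∀ v, σ * ‖v‖ ≤ ‖(fderiv ℝ (ABC.abc 1 1 1) a + G' a) v‖)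
    (hG : ∀ x ∈ closedBall a R, HasFDerivAt G (G' x) x)
    (hlipG : ∀ x ∈ closedBall a R, ‖G' x - G' a‖ ≤ M * ‖x - a‖)
    (h₁ : (1 + M) * R < σ) (h₂ : (1 + M) * R ^ 2 + ‖ABC.abc 1 1 1 a + G a‖ ≤ σ * R) :
    ∃ z ∈ closedBall a R, ABC.abc 1 1 1 z + G z = 0 ∧ (fderiv ℝ (ABC.abc 1 1 1) z + G' z).IsInvertible ∧
      ∀ y ∈ closedBall a R, ABC.abc 1 1 1 y + G y = 0 → y = z := by
  obtain ⟨A, hA, hβ⟩ := exists_equiv_of_bound_below (fderiv ℝ (ABC.abc 1 1 1) a + G' a) hσ hbelow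
  have hβ0 : 0 ≤ ‖(A.symm : EuclideanSpace ℝ (Fin 3) →L[ℝ] EuclideanSpace ℝ (Fin 3))‖ := norm_nonneg _
  have hη : ‖A.symm (ABC.abc 1 1 1 a + G a)‖ ≤ ‖ABC.abc 1 1 1 a + G a‖ / σ := by
    calc ‖A.symm (ABC.abc 1 1 1 a + G a)‖
        = ‖(A.symm : EuclideanSpace ℝ (Fin 3) →L[ℝ] EuclideanSpace ℝ (Fin 3)) (ABC.abc 1 1 1 a + G a)‖ := rfl
      _ ≤ ‖(A.symm : EuclideanSpace ℝ (Fin 3) →L[ℝ] EuclideanSpace ℝ (Fin 3))‖ * ‖ABC.abc 1 1 1 a + G a‖ :=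
          ContinuousLinearMap.le_opNorm _ _
      _ ≤ 1 / σ * ‖ABC.abc 1 1 1 a + G a‖ := mul_le_mul_of_nonneg_right hβ (norm_nonneg _)
      _ = ‖ABC.abc 1 1 1 a + G a‖ / σ := by ring
  have hM' : 0 ≤ (1 + M) * R := by positivity
  have h₁' : (1 + M) * R * ‖(A.symm : EuclideanSpace ℝ (Fin 3) →L[ℝ] EuclideanSpace ℝ (Fin 3))‖ < 1 := by
    calc (1 + M) * R * ‖(A.symm : EuclideanSpace ℝ (Fin 3) →L[ℝ] EuclideanSpace ℝ (Fin 3))‖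
        ≤ (1 + M) * R * (1 / σ) := by gcongr
      _ = ((1 + M) * R) / σ := by ring
      _ < 1 := by rw [div_lt_one hσ]; exact h₁
  have h₂' : (1 + M) * R ^ 2 * ‖(A.symm : EuclideanSpace ℝ (Fin 3) →L[ℝ] EuclideanSpace ℝ (Fin 3))‖ +
      ‖A.symm (ABC.abc 1 1 1 a + G a)‖ ≤ R := by
    have hMR2 : 0 ≤ (1 + M) * R ^ 2 := by positivity
    calc (1 + M) * R ^ 2 * ‖(A.symm : EuclideanSpace ℝ (Fin 3) →L[ℝ] EuclideanSpace ℝ (Fin 3))‖ +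
          ‖A.symm (ABC.abc 1 1 1 a + G a)‖
        ≤ (1 + M) * R ^ 2 * (1 / σ) + ‖ABC.abc 1 1 1 a + G a‖ / σ := by gcongr
      _ = ((1 + M) * R ^ 2 + ‖ABC.abc 1 1 1 a + G a‖) / σ := by ring
      _ ≤ (σ * R) / σ := by gcongr
      _ = R := by field_simp
  exact existsUnique_zero_ball_near a hR hM hA.symm hG hlipG h₁' h₂'

/-! ## §4 (appended, instab2 g7) The remainder lemma behind the instrument's radial bound `M`

How `skeleton_persist.py` v1.2 produces the number `M` of §1–§3 for a velocity snapshot: `G(x) = Σ_k Ĝ_k e^{ik·x}`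
(finite sum), so `∇G(p + y) − ∇G(p) = Σ_k (ik ⊗ Ĝ_k) e^{ik·p} (e^{ik·y} − 1)`; expanding `e^{ik·y}` to order `m`
gives the exact derivative tensors of `G` at `p` (evaluated spectrally) plus a remainder controlled, mode by mode, by
the one-variable estimate `|e^{it} − Σ_{l≤m} (it)^l/l!| ≤ |t|^{m+1}/(m+1)!` (Durrett 1991, (3.6); tree:
`Literature.Analysis.Distribution.norm_exp_mul_I_sub_sum_le`) at `t = k·y`, with `|k·y| ≤ |k||y|`. The form used,
per mode: -/

/-- **Taylor remainder of a single Fourier mode**: for `k, y ∈ E` and every order `N`,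
`‖e^{i⟨k,y⟩} − Σ_{l ≤ N} (i⟨k,y⟩)^l / l!‖ ≤ (|k|·|y|)^{N+1}/(N+1)!` (the one-variable bound at `t = ⟨k, y⟩` and
Cauchy–Schwarz). Summed over the modes with weights `|k|·|Ĝ_k|` this is the tail term
`|y|^{m+1} Σ_k |k|^{m+2}|Ĝ_k|/(m+1)!` of the instrument's bound on `‖∇G(p + y) − ∇G(p)‖`. -/
theorem norm_exp_inner_mul_I_sub_sum_le (k y : EuclideanSpace ℝ (Fin 3)) (N : ℕ) :
    ‖Complex.exp (((inner ℝ k y : ℝ) : ℂ) * Complex.I) -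
        ∑ l ∈ Finset.range (N + 1), (((inner ℝ k y : ℝ) : ℂ) * Complex.I) ^ l / (Nat.factorial l : ℂ)‖ ≤
      (‖k‖ * ‖y‖) ^ (N + 1) / (Nat.factorial (N + 1) : ℝ) := by
  have h := Literature.Analysis.Distribution.norm_exp_mul_I_sub_sum_le N (inner ℝ k y)
  have hcs : |inner ℝ k y| ≤ ‖k‖ * ‖y‖ := abs_real_inner_le_norm k y
  have hpow : |inner ℝ k y| ^ (N + 1) ≤ (‖k‖ * ‖y‖) ^ (N + 1) :=
    pow_le_pow_left₀ (abs_nonneg _) hcs (N + 1)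
  have hfac : (0 : ℝ) < (Nat.factorial (N + 1) : ℝ) := by exact_mod_cast Nat.factorial_pos _
  exact h.trans (div_le_div_of_nonneg_right hpow hfac.le)

end Summit.NavierStokesRegularity.FluidComputer.ABCSkeletonPersistenceNewton
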